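import Summits.BirchSwinnertonDyer.BirchSwinnertonDyer.Theses.TwistFamilyManinDescent
import Summits.BirchSwinnertonDyer.Rank1Residual.ManinAdditive.NeronFLineDepth
import Literature.NumberTheory.EllipticCurves.CuspFormLFunction
import Literature.NumberTheory.EllipticCurves.ModularCurveManinConstantProofs

/-!
# Split-Cartan block localisation — First-lemma sketch + CALIBRATED typed transfer (crux stmt-BirchSwinnertonDyer-25138)

Seat-1 crux-idea card `split-cartan-block-localisation` (card 3, g3, commit edb1eb866e8f) cites a g3 session file
`Sketch3.lean` that no longer exists.  This file REBUILDS its checkable content (g6) and adds the typed TRANSFER of the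
crux into the tree's Néron-`f`-line currency (`Summit.BirchSwinnertonDyer.Rank1Residual.ManinAdditive.NeronFLineDatum`,
landed after the card was written), in the form the calibration (`Ideas/etale-quotient-depth-calibration.md` §§3–7,
`CENSUS-lambda-eis57.md`, `CENSUS-lambda2-eis57.md`) leaves standing:

* §A (card 3's objects): the Fricke-integral lattice `S ∩ w_N⁻¹ S` (`frickeIntegralCuspForms0`; the census column
  `t_{L_red}` uses `w_{p²}` at `p² ∥ N`), its `f`-line index `frickeCongruenceNumber`, and card-3 K1's `S`-lattice shadow
  `SameSignRibetInequality` : `v_p(deg φ) ≤ v_p [e_f (S ∩ w_N⁻¹S) : ℤ f]` (an S-lattice statement, E-free).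
* §B (transfer, calibrated): for a Néron lattice ASSIGNMENT `𝓛` (the posited construction D-desc-g4-1: `(𝓛 W D).Λ` = the
  `q`-expansion lattice of `H⁰(𝒥₀(N)_ℤ, Ω¹)`; E-BLIND — it depends on `N` and `f` only),
  `(ΛM) LatticeDepthOnCruxRows 𝓛` := on every crux row the Néron congruence depth holds, and the PROVED link
  `crux_of_latticeDepth : LatticeDepthOnCruxRows 𝓛 → EisensteinAdditiveManinResidual`.
  Calibration: `(ΛM)` ⟺ `u = w = 0` on the row (identity (E1) `v_p(m_E) = t_Λ + u + w`); it HOLDS on 27/27 crux rows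
  (E[p] reducible, twist-minimal additive, `p ∈ {5,7}`, `N ≤ 650`, two independent engines + seat-2's third) and FAILS
  off the crux at 350e1 / 99d1 (`u = 1`, E[p] irreducible) — so `(ΛM)` is crux-specific, not a general law, and any line
  must USE reducibility (cards 2/3: the Eisenstein block of `𝕋_𝔪`).
* §C (E-free split of (ΛM)): `(β^{AL}) ALCutMissesFLine 𝓛` (the AL-unstable directions cut out of `S^{AL}` to get `Λ`
  miss the `f`-line `p`-adically on crux rows) + the `p`-adic shadow of the cell law E-desc-26 on crux rows
  (`ALStableIndexEqDegreeOnCruxRows`; tree: `ALStableCongruenceLaw`, 59/59) + the lattice-algebra support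
  `LineIndexRealisation` (the `f`-line index of `Λ ∋ f` is realised by a generator: TRUE for every interface instance,
  prover-sized) ⇒ `(ΛM)`; PROVED here: `latticeDepth_of_alCut`, `crux_of_alCut`.

Nothing here asserts `(ΛM)`, `(β^{AL})` or E-desc-26; they are `def … : Prop` targets.  BSD is not proved by this;
Manin `c = 1` is not proved by this.
-/

noncomputable section

set_option linter.dupNamespace false

open scoped MatrixGroups ModularForm

open CongruenceSubgroup WeierstrassCurve Literature.NumberTheory.EllipticCurves.ModularForms
open Summit.BirchSwinnertonDyer.Rank1Residual.ManinAdditive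

namespace Summit.BirchSwinnertonDyer.BirchSwinnertonDyer.Cruxes.EisensteinAdditiveManinResidual.SplitCartanBlockLocalisation

/-! ### §A  Card 3's S-lattice objects -/

section CardThree

variable (N : ℕ) [NeZero N]

/-- The Fricke-integral lattice `S^W := S₂(Γ₀(N), ℤ) ∩ w_N⁻¹ S₂(Γ₀(N), ℤ)`: forms integral at `∞` AND at `0`. -/
def frickeIntegralCuspForms0 : Submodule ℤ (CuspForm (Gamma0 N) 2) :=
  integralCuspForms0 N 2 ⊓ (integralCuspForms0 N 2).comap ((frickeInvolution N 2).restrictScalars ℤ)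

theorem frickeIntegralCuspForms0_le : frickeIntegralCuspForms0 N ≤ integralCuspForms0 N 2 := inf_le_left

variable {N}

/-- The Fricke congruence number of `f`: the `f`-line index `[e_f S^W : ℤ f]` (card 3: the same-sign companion of
Ribet's congruence number `congruenceNumber f = lineIndex (integralCuspForms0 N 2) f`). -/
def frickeCongruenceNumber (f : CuspForm (Gamma0 N) 2) : ℕ := lineIndex (frickeIntegralCuspForms0 N) f

/-- **Card 3, K1 (S-lattice shadow; E-free, a statement about `X₀(N)` and `f`).** For a lattice-optimal datum of minimal
degree and an odd prime `p` with `p² ∣ N`, the modular degree's `p`-part survives the Fricke cut: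
`v_p(deg φ) ≤ v_p [e_f S^W : ℤ f]`.  (Semistable shadow: Agashe–Ribet–Stein 2012 Thm 2.1 `deg φ ∣ r_f`; census column
`t_{L_red} ≥ v_p(m_E)` on every valid row of CENSUS-lambda2-eis57.) -/
def SameSignRibetInequality : Prop :=
  ∀ (W : WeierstrassCurve ℚ) [W.IsElliptic] {N : ℕ} [NeZero N] (D : ModularParametrizationData W N),
    (∀ z ∈ D.L.lattice, ∃ w ∈ periodLattice D.f, z = D.c * w) →
    (∀ (W' : WeierstrassCurve ℚ) [W'.IsElliptic] (D' : ModularParametrizationData W' N),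
      D'.f = D.f → D.modularDegree ≤ D'.modularDegree) →
    ∀ p : ℕ, p.Prime → p ≠ 2 → p ^ 2 ∣ N →
      padicValNat p D.modularDegree ≤ padicValNat p (frickeCongruenceNumber D.f)

end CardThree

/-! ### §B  The crux row, Néron lattice assignments, and the calibrated transfer `(ΛM) ⇒ crux` -/

/-- The hypotheses of ONE row of the crux `EisensteinAdditiveManinResidual`, bundled verbatim: `p ∈ {5,7,13}` (or the CM
corner `p = 163 ∧ 2⁶ ∣ N`), `p² ∣ N`, `E[p]` reducible, the twist by `p* = (−1)^{(p−1)/2} p` neither good nor multiplicative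
at `p` (twist-minimal additive), and lattice-optimality `Λ_W = c · Λ_f`. -/
def IsCruxRow (W : WeierstrassCurve ℚ) [W.IsElliptic] [W.IsGloballyMinimal] {N : ℕ} [NeZero N]
    (D : ModularParametrizationData W N) (p : ℕ) (hp : p.Prime) : Prop :=
  (p = 5 ∨ p = 7 ∨ p = 13 ∨ (p = 163 ∧ 2 ^ 6 ∣ N)) ∧ p ^ 2 ∣ N ∧ ¬ W.HasIrreducibleModPGaloisRep p ∧
    ¬ ((W.quadraticTwist (((-1 : ℤ) ^ (p / 2) * p : ℤ) : ℚ)).HasGoodReductionAt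
          ((Rat.HeightOneSpectrum.primesEquiv (R := ℤ)).symm ⟨p, hp⟩) ∨
        (W.quadraticTwist (((-1 : ℤ) ^ (p / 2) * p : ℤ) : ℚ)).HasMultiplicativeReductionAt
          ((Rat.HeightOneSpectrum.primesEquiv (R := ℤ)).symm ⟨p, hp⟩)) ∧
    (∀ z ∈ D.L.lattice, ∃ w ∈ periodLattice D.f, z = D.c * w)

/-- A Néron `f`-line lattice ASSIGNMENT: a `NeronFLineDatum` for every parametrisation datum.  The intended instance is
the CONSTRUCTION D-desc-g4-1 (the `q`-expansion lattice of `H⁰(𝒥₀(N)_ℤ, Ω¹)` with `ξ^* = φ^* ∘ (Néron scaling)`); it is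
a parameter here, never an axiom (refuter-1's junk models J1/J2: depth predicates stay GIVEN-datum predicates). -/
def LatticeAssignment : Type :=
  ∀ {N : ℕ} [NeZero N] (W : WeierstrassCurve ℚ) [W.IsElliptic] (D : ModularParametrizationData W N), NeronFLineDatum W D

/-- **(ΛM) for `𝓛`** — the calibrated transfer target: on every crux row the Néron congruence depth holds for the
assigned lattice (`∃ g ∈ Λ` with `f`-coordinate of valuation exactly `−v_p(deg φ)`).  By (E1) this is `u = w = 0` on
the row: TRUE on 27/27 computed crux rows, FALSE off-crux at 350e1 (so: not a general law; reducibility is used). -/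
def LatticeDepthOnCruxRows (𝓛 : LatticeAssignment) : Prop :=
  ∀ (W : WeierstrassCurve ℚ) [W.IsElliptic] [W.IsGloballyMinimal] {N : ℕ} [NeZero N]
    (D : ModularParametrizationData W N) (p : ℕ) (hp : p.Prime), IsCruxRow W D p hp →
    (𝓛 W D).NeronCongruenceDepthAt p

/-- **Transfer, PROVED: `(ΛM)` for any assignment ⇒ the crux** (via the tree's
`NeronFLineDatum.not_dvd_maninConstant_of_depth`: `ξ^*(g) = κ q ∈ ℤ`, `κ c = deg φ`). -/
theorem crux_of_latticeDepth (𝓛 : LatticeAssignment) (h : LatticeDepthOnCruxRows 𝓛) :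
    Theses.TwistFamilyManinDescent.EisensteinAdditiveManinResidual := by
  intro _ _ _ _ W _ _ N _ D p hp h1 h2 h3 h4 h5
  haveI : Fact p.Prime := ⟨hp⟩
  exact (𝓛 W D).not_dvd_maninConstant_of_depth (h W D p hp ⟨h1, h2, h3, h4, h5⟩)

/-! ### §C  The E-free split of (ΛM): AL cut misses the f-line + E-desc-26 shadow + lattice algebra -/

/-- **(β^{AL}) for `𝓛`** (E-free; a statement about `X₀(N)`, `f` and the prime `p` on crux rows): passing from the
AL-stable lattice `S^{AL}` down to the Néron lattice `Λ ⊆ S^{AL}` (`Λ_le_alStableLattice`) does not change the `p`-adic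
`f`-line index.  Card 3's mechanism for it: the cut `S^{AL}/Λ` is supported on the middle-cusp (multiplicity-`(p−1)`)
conditions, which live in crossed tame types / the Eisenstein block misses them. -/
def ALCutMissesFLine (𝓛 : LatticeAssignment) : Prop :=
  ∀ (W : WeierstrassCurve ℚ) [W.IsElliptic] [W.IsGloballyMinimal] {N : ℕ} [NeZero N]
    (D : ModularParametrizationData W N) (p : ℕ) (hp : p.Prime), IsCruxRow W D p hp →
    padicValNat p (lineIndex (𝓛 W D).Λ D.f) = padicValNat p (lineIndex (alStableLattice N) D.f)

/-- **E-desc-26, `p`-adic shadow on crux rows** (cell law `ALStableCongruenceLaw`, 59/59 classes at all-rational levels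
`N ≤ 384`; here only its `p`-part and only on crux rows is needed): `v_p [e_f S^{AL} : ℤ f] = v_p(deg φ)`. -/
def ALStableIndexEqDegreeOnCruxRows : Prop :=
  ∀ (W : WeierstrassCurve ℚ) [W.IsElliptic] [W.IsGloballyMinimal] {N : ℕ} [NeZero N]
    (D : ModularParametrizationData W N) (p : ℕ) (hp : p.Prime), IsCruxRow W D p hp →
    padicValNat p (lineIndex (alStableLattice N) D.f) = padicValNat p D.modularDegree

/-- **Support (lattice algebra, TRUE for every interface instance; prover-sized).** If `f ∈ Λ` then the `f`-coordinate
map `g ↦ ⟨f,g⟩/⟨f,f⟩ = ξ^*(g)/κ` sends `Λ` onto a cyclic group `(1/r)ℤ ∋ 1` with `r = lineIndex Λ f`, so a generator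
`g₀` has coordinate `q = ±1/r`: `v_p(q) = −v_p [e_f Λ : ℤ f]` exactly. -/
def LineIndexRealisation : Prop :=
  ∀ {N : ℕ} [NeZero N] (W : WeierstrassCurve ℚ) [W.IsElliptic] (D : ModularParametrizationData W N)
    (Δ : NeronFLineDatum W D) (p : ℕ), p.Prime → D.f ∈ Δ.Λ →
    ∃ g : Δ.Λ, ∃ q : ℚ, q ≠ 0 ∧
      (q : ℂ) * peterssonProduct (Gamma0 N) 2 D.f D.f = peterssonProduct (Gamma0 N) 2 D.f g ∧
      padicValRat p q = -(padicValNat p (lineIndex Δ.Λ D.f) : ℤ)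

/-- **PROVED: the E-free split gives (ΛM).**  `f ∈ Λ` (ČNS: `ω_f` is a global section of `Ω` on the regular model —
the `Λ ∋ f` certificate of every census level) + realisation + `(β^{AL})` + E-desc-26 shadow ⇒ `(ΛM)`. -/
theorem latticeDepth_of_alCut (𝓛 : LatticeAssignment)
    (hmem : ∀ {N : ℕ} [NeZero N] (W : WeierstrassCurve ℚ) [W.IsElliptic] (D : ModularParametrizationData W N),
      D.f ∈ (𝓛 W D).Λ)
    (hreal : LineIndexRealisation) (hcut : ALCutMissesFLine 𝓛) (h26 : ALStableIndexEqDegreeOnCruxRows) :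
    LatticeDepthOnCruxRows 𝓛 := by
  intro W _ _ N _ D p hp hrow
  obtain ⟨g, q, hq0, hq, hval⟩ := hreal W D (𝓛 W D) p hp (hmem W D)
  refine ⟨g, q, hq0, hq, ?_⟩
  rw [hval, hcut W D p hp hrow, h26 W D p hp hrow]

/-- **PROVED composition: the crux from the E-free split** (for any assignment with `f ∈ Λ`). -/
theorem crux_of_alCut (𝓛 : LatticeAssignment)
    (hmem : ∀ {N : ℕ} [NeZero N] (W : WeierstrassCurve ℚ) [W.IsElliptic] (D : ModularParametrizationData W N),
      D.f ∈ (𝓛 W D).Λ)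
    (hreal : LineIndexRealisation) (hcut : ALCutMissesFLine 𝓛) (h26 : ALStableIndexEqDegreeOnCruxRows) :
    Theses.TwistFamilyManinDescent.EisensteinAdditiveManinResidual :=
  crux_of_latticeDepth 𝓛 (latticeDepth_of_alCut 𝓛 hmem hreal hcut h26)

/-- Bookkeeping in the other direction (what a census row with `p ∣ deg φ` and `(ΛM)` certifies): the depth witness
forces `p ∤ c` AND a `ξ^*`-unit, i.e. Lie saturation at `p` (tree: `depthAt_iff`). -/
theorem lieSaturated_of_latticeDepth (𝓛 : LatticeAssignment) (h : LatticeDepthOnCruxRows 𝓛)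
    (W : WeierstrassCurve ℚ) [W.IsElliptic] [W.IsGloballyMinimal] {N : ℕ} [NeZero N]
    (D : ModularParametrizationData W N) (p : ℕ) (hp : p.Prime) (hrow : IsCruxRow W D p hp) :
    ¬ (p : ℤ) ∣ D.maninConstant ∧ (𝓛 W D).LieSaturatedAt p := by
  haveI : Fact p.Prime := ⟨hp⟩
  exact ((𝓛 W D).depthAt_iff).mp (h W D p hp hrow)

end Summit.BirchSwinnertonDyer.BirchSwinnertonDyer.Cruxes.EisensteinAdditiveManinResidual.SplitCartanBlockLocalisation

end
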